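import Summits.BirchSwinnertonDyer.BirchSwinnertonDyer.Theorems.AlignedTransportAtTwoMainConjectureOfRankZeroBSDAtTwoCyclotomicLayerRankJumpExact
import Summits.BirchSwinnertonDyer.BirchSwinnertonDyer.Theorems.AlignedTransportAtTwoMainConjectureOfRankZeroBSDAtTwoCyclotomicLayerRoadStationary
import HarnessLib

/-!
# Route `AlignedTransportAtTwo`, crux C2 `MainConjectureOfRankZeroBSDAtTwo` (stmt-BirchSwinnertonDyer-22298):
# THE RANK PROFILE OF THE `a₂ = +1` ROAD — along the whole cyclotomic `ℤ₂`-tower, `rank W(ℚ_m) ∈ {r₁, r₁ + (λ₂ − 1)}` with `r₁ = rank W(ℚ(√2)) ≤ 1`: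
# at most ONE jump above `ℚ₁`, of size EXACTLY `λ₂ − 1 = 2^{n₀}`, in the layer `ℚ_{n₀+1}/ℚ_{n₀}`

HONEST FRAMING (cell `bsd-f1-sign2`, WIDTH-5 attached prover seat `bsd-line-att-p5` gen 36 on line `birth` of the lead `bsd-line-att-p2`;
`--supports` stmt-BirchSwinnertonDyer-22298, closes nothing; BSD is NOT proved by any of this; the crux C2, its verdict «blocked-on
`Rank1Residual.GreenbergMuConjectureIrreducible`» and every registered stub are untouched). THEOREMS ONLY — no `def`, no named fact, no `sorry`; print binders exactly the
lineage's (`h17` = Kato 17.4 (1)(2) at `2`; `hGZK` only where `rank W(ℚ) = 0` is read from `r_an = 0`). Assembly of this gen's EXACT JUMP (`…RankJumpExact`: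
`rank W(ℚ_{n+1}) = rank W(ℚ_n) + 2ⁿ·c` with `Φ_{2^{n+1}}(1+T)^c ∣ f_X`) with the road shape `f_X · a = 2ᵐ·(T+2)·H`, `H` PRIME (g33–g35): `Φ² ∤ (T+2)·H` for the layer prime
`Φ ≠ T+2`, so `c ≤ 1`, and `c = 1` forces `λ₂ = 2ⁿ + 1` (`…CyclotomicLayerRoad`).

* `cyclotomicLayer_sq_not_dvd_charGen_of_road` — `n ≥ 1 ⇒ Φ_{2^{n+1}}(1+T)² ∤ f_X` on the road.
* ★★ `mordellWeilRank_layer_succ_eq_or_of_road` — **`n ≥ 1`: `rank W(ℚ_{n+1}) = rank W(ℚ_n)`, OR `rank W(ℚ_{n+1}) = rank W(ℚ_n) + 2ⁿ` AND `λ₂ = 2ⁿ + 1`.**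
* ★★★ `mordellWeilRank_layer_eq_or_eq_add_of_road` — **for every `m ≥ 1`: `rank W(ℚ_m) = rank W(ℚ₁)` OR `rank W(ℚ_m) = rank W(ℚ₁) + (λ₂ − 1)`** (and in the second case
  `λ₂ = 2^{n₀} + 1` for some `1 ≤ n₀ < m`: the jump happened in the layer `ℚ_{n₀+1}/ℚ_{n₀}`); `mordellWeilRank_layer_le_one_or_of_road` (`+ hGZK`: **`rank W(ℚ_m) ≤ 1` OR `λ₂ − 1 ≤ rank W(ℚ_m) ≤ λ₂`**).
  In the second case the lineage's door «rank `≥ 2` somewhere up the tower ⟹ `MazurMainConjecture W 2`» (g34 `mazurMainConjecture_two_of_road_of_layerRankGEAt_two`) fires.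

References: R. Greenberg, LNM 1716 (1999), Thm. 1.9, §5 pp. 132, 176–177 [GreenbergLNM1716]; K. Kato, Astérisque 295 (2004), Thm. 17.4 [Kato2004Asterisque].
-/

set_option linter.dupNamespace false
set_option autoImplicit false

noncomputable section

open scoped Classical MatrixGroups ModularForm Polynomial

namespace Summit.BirchSwinnertonDyer.BirchSwinnertonDyer.Theorems.AlignedTransportAtTwoCyclotomicLayerRoadProfile

open PowerSeries CongruenceSubgroup WeierstrassCurve Literature.NumberTheory.EllipticCurves
  Literature.NumberTheory.EllipticCurves.ModularForms
  Literature.NumberTheory.EllipticCurves.Rank1Residual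
  Literature.NumberTheory.EllipticCurves.Rank1Residual.Typed
  Literature.NumberTheory.EllipticCurves.Greenberg1999
  Summit.BirchSwinnertonDyer.Rank1Residual
  Summit.BirchSwinnertonDyer.Rank1Residual.X1.MuLambda
  Summit.BirchSwinnertonDyer.Rank1Residual.X5
  Summit.BirchSwinnertonDyer.Rank1Residual.F1Sign2
  Summit.BirchSwinnertonDyer.Rank1Residual.Iwasawa
  Summit.BirchSwinnertonDyer.BirchSwinnertonDyer.Theorems.Rank1ResidualX1Defs
  Summit.BirchSwinnertonDyer.BirchSwinnertonDyer.Theorems.AlignedTransportAtTwoSeed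
  Summit.BirchSwinnertonDyer.BirchSwinnertonDyer.Theorems.AlignedTransportAtTwoTwoFixedPoints
  Summit.BirchSwinnertonDyer.BirchSwinnertonDyer.Theorems.AlignedTransportAtTwoEisensteinRigidityRoad
  Summit.BirchSwinnertonDyer.BirchSwinnertonDyer.Theorems.AlignedTransportAtTwoEisensteinRigidityPrime
  Summit.BirchSwinnertonDyer.BirchSwinnertonDyer.Theorems.AlignedTransportAtTwoLayerOneRankBound
  Summit.BirchSwinnertonDyer.BirchSwinnertonDyer.Theorems.AlignedTransportAtTwoCyclotomicLayerPrime
  Summit.BirchSwinnertonDyer.BirchSwinnertonDyer.Theorems.AlignedTransportAtTwoCyclotomicLayerRankGrowth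
  Summit.BirchSwinnertonDyer.BirchSwinnertonDyer.Theorems.AlignedTransportAtTwoCyclotomicLayerRoad
  Summit.BirchSwinnertonDyer.BirchSwinnertonDyer.Theorems.AlignedTransportAtTwoCyclotomicLayerRankDichotomy
  Summit.BirchSwinnertonDyer.BirchSwinnertonDyer.Theorems.AlignedTransportAtTwoCyclotomicLayerRankBudget
  Summit.BirchSwinnertonDyer.BirchSwinnertonDyer.Theorems.AlignedTransportAtTwoCyclotomicLayerLFunction
  Summit.BirchSwinnertonDyer.BirchSwinnertonDyer.Theorems.AlignedTransportAtTwoCyclotomicLayerRoadStationary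
  Summit.BirchSwinnertonDyer.BirchSwinnertonDyer.Theorems.AlignedTransportAtTwoCyclotomicLayerRankJumpExact
  Summit.BirchSwinnertonDyer.BirchSwinnertonDyer.Theorems.DefectPrime

variable (W : WeierstrassCurve ℚ) [W.IsElliptic] [W.IsGloballyMinimal]

/-- **On the `a₂ = +1` road, `Φ_{2^{n+1}}(1+T)² ∤ f_X` (`n ≥ 1`)** at every cyclotomic datum: `f_X · a = 2ᵐ·(T+2)·H` with `H` prime (Eisenstein), and the layer prime `Φ ≠ T+2`
would have to divide the irreducible `H` twice. [cite: Kato2004Asterisque, Thm. 17.4 (1)(2) (p. 273)] [cite: GreenbergLNM1716, §5 p. 176] -/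
theorem cyclotomicLayer_sq_not_dvd_charGen_of_road [NeZero (W.conductorNorm ℤ)] {f : CuspForm (Gamma0 (W.conductorNorm ℤ)) 2}
    (h17 : kato_divisibility_allPrimes W 2 (f := f)) (hord : IsOrdinaryAt W 2) (hf : IsNewformOf W f)
    (ha : W.frobeniusTrace 2 = 1) (hodd : Odd W.tamagawaProduct)
    (hΔ : minimalDiscriminantInt W % 8 = 3 ∨ minimalDiscriminantInt W % 8 = 5) (hr : W.analyticRank = 0)
    {G : IwasawaAlgebra 2} (hG : iwasawaToPowerSeries 2 G = padicLFunction f (unitRoot W 2 : ℚ_[2]))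
    (hμ : mu G = 0) (hsym : ‖(ratPlusSymbol f 0 : ℚ_[2])‖ = 1)
    {κ : ZpExtension ℚ 2} {γ : Field.absoluteGaloisGroup ℚ} (hκ : κ.IsCyclotomic) (hγ : κ.IsTopGenerator γ)
    (hγ' : IsCyclotomicVariable 2 γ) (D : W.SelmerDualData κ γ) {fX : IwasawaAlgebra 2} (hchar : D.charIdeal = Ideal.span {fX})
    {n : ℕ} (hn : 1 ≤ n) :
    ¬ (((Polynomial.cyclotomic (2 ^ (n + 1)) ℤ_[2]).comp (Polynomial.X + 1) : ℤ_[2][X]) : PowerSeries ℤ_[2]) ^ 2 ∣ fX := by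
  intro hdvd
  obtain ⟨-, -, -, -, H, a, m, -, hHn, -, -, -, -, hrel⟩ :=
    charGen_shape_of_road W h17 hord hf ha hodd hΔ hr hG hμ hsym hκ hγ hγ' D hchar
  have hΨ := prime_coe_cyclotomic_comp 2 n
  have h1 : (((Polynomial.cyclotomic (2 ^ (n + 1)) ℤ_[2]).comp (Polynomial.X + 1) : ℤ_[2][X]) : PowerSeries ℤ_[2]) ^ 2 ∣
      (X + C (2 : ℤ_[2])) * H :=
    cyclotomicLayer_pow_dvd_of_dvd_C_mul n 2 m (by rw [← hrel]; exact dvd_mul_of_dvd_left hdvd a)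
  -- `Φ ∤ T+2` (`λ(Φ) = 2ⁿ ≥ 2 > 1`), so `Φ² ∣ H`
  have hnot : ¬ (((Polynomial.cyclotomic (2 ^ (n + 1)) ℤ_[2]).comp (Polynomial.X + 1) : ℤ_[2][X]) : PowerSeries ℤ_[2]) ∣
      (X + C (2 : ℤ_[2])) := by
    rintro ⟨q, hq⟩
    have hq0 : q ≠ 0 := by rintro rfl; exact prime_X_add_C_two.ne_zero (by rw [hq, mul_zero])
    have h := congrArg lam hq
    rw [lam_X_add_C_two, lam_mul hΨ.ne_zero hq0, lam_cyclotomicLayer] at h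
    have : 2 ≤ 2 ^ n * (2 - 1) := by simpa using Nat.pow_le_pow_right two_pos hn
    omega
  have h2 := hΨ.pow_dvd_of_dvd_mul_left 2 hnot h1
  obtain ⟨u, hu⟩ := h2
  have hHprime : Prime H := prime_of_norm_constantCoeff_eq_half hHn
  have hu' : H = (((Polynomial.cyclotomic (2 ^ (n + 1)) ℤ_[2]).comp (Polynomial.X + 1) : ℤ_[2][X]) : PowerSeries ℤ_[2]) *
      ((((Polynomial.cyclotomic (2 ^ (n + 1)) ℤ_[2]).comp (Polynomial.X + 1) : ℤ_[2][X]) : PowerSeries ℤ_[2]) * u) := by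
    rw [hu, pow_two, mul_assoc]
  rcases hHprime.irreducible.isUnit_or_isUnit hu' with hU | hU
  · exact hΨ.not_unit hU
  · exact hΨ.not_unit (isUnit_of_mul_isUnit_left hU)

/-- ★★ **ONE LAYER OF THE `a₂ = +1` ROAD (`n ≥ 1`): `rank W(ℚ_{n+1}) = rank W(ℚ_n)`, OR (`rank W(ℚ_{n+1}) = rank W(ℚ_n) + 2ⁿ` AND `λ₂ = 2ⁿ + 1`).** The exact jump is `2ⁿ·c` with
`Φ_{2^{n+1}}(1+T)^c ∣ f_X`; `c ≤ 1` by `cyclotomicLayer_sq_not_dvd_charGen_of_road`, and `c = 1` forces `λ₂ = 2ⁿ + 1` (`lam_eq_two_pow_add_one_of_road_of_cyclotomicLayer_dvd`).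
[cite: Kato2004Asterisque, Thm. 17.4 (1)(2) (p. 273)] [cite: GreenbergLNM1716, §5 p. 132 and p. 177] -/
theorem mordellWeilRank_layer_succ_eq_or_of_road [NeZero (W.conductorNorm ℤ)] {f : CuspForm (Gamma0 (W.conductorNorm ℤ)) 2}
    (h17 : kato_divisibility_allPrimes W 2 (f := f)) (hord : IsOrdinaryAt W 2) (hf : IsNewformOf W f)
    (ha : W.frobeniusTrace 2 = 1) (hodd : Odd W.tamagawaProduct)
    (hΔ : minimalDiscriminantInt W % 8 = 3 ∨ minimalDiscriminantInt W % 8 = 5) (hr : W.analyticRank = 0)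
    {G : IwasawaAlgebra 2} (hG : iwasawaToPowerSeries 2 G = padicLFunction f (unitRoot W 2 : ℚ_[2]))
    (hμ : mu G = 0) (hsym : ‖(ratPlusSymbol f 0 : ℚ_[2])‖ = 1)
    {κ : ZpExtension ℚ 2} {γ : Field.absoluteGaloisGroup ℚ} (hκ : κ.IsCyclotomic) (hγ : κ.IsTopGenerator γ)
    (hγ' : IsCyclotomicVariable 2 γ) {n : ℕ} (hn : 1 ≤ n) :
    (W.baseChange (κ.layer (n + 1))).mordellWeilRank = (W.baseChange (κ.layer n)).mordellWeilRank ∨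
      ((W.baseChange (κ.layer (n + 1))).mordellWeilRank = (W.baseChange (κ.layer n)).mordellWeilRank + 2 ^ n ∧ lam G = 2 ^ n + 1) := by
  obtain ⟨D⟩ := W.nonempty_selmerDualData_holds κ γ hγ
  haveI : Module.Finite (IwasawaAlgebra 2) D.X := D.module_finite_holds hγ
  haveI : (Module.charIdeal (IwasawaAlgebra 2) D.X).IsPrincipal := charIdeal_isPrincipal_holds 2 D.X
  obtain ⟨fX, hfX⟩ := Submodule.IsPrincipal.principal (Module.charIdeal (IwasawaAlgebra 2) D.X)
  have hchar : D.charIdeal = Ideal.span {fX} := hfX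
  have hD : D.IsTorsion := (charGen_shape_of_road W h17 hord hf ha hodd hΔ hr hG hμ hsym hκ hγ hγ' D hchar).1
  obtain ⟨c, hdvd, hc⟩ := exists_cyclotomicLayer_pow_dvd_and_mordellWeilRank_eq W hγ D hD (hchar ▸ Ideal.mem_span_singleton_self fX) n
  -- restate in this file's elaboration of `rank W(ℚ_m)` (the `ℚ`-algebra structure on a layer has two defeq spellings)
  have hc' : (W.baseChange (κ.layer (n + 1))).mordellWeilRank = (W.baseChange (κ.layer n)).mordellWeilRank + 2 ^ n * (2 - 1) * c := hc
  have hc1 : c ≤ 1 := by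
    by_contra hlt
    exact cyclotomicLayer_sq_not_dvd_charGen_of_road W h17 hord hf ha hodd hΔ hr hG hμ hsym hκ hγ hγ' D hchar hn
      (dvd_trans (pow_dvd_pow _ (by omega)) hdvd)
  rcases Nat.le_one_iff_eq_zero_or_eq_one.mp hc1 with rfl | rfl
  · left; omega
  · right
    refine ⟨by omega, ?_⟩
    rw [pow_one] at hdvd
    exact lam_eq_two_pow_add_one_of_road_of_cyclotomicLayer_dvd W h17 hord hf ha hodd hΔ hr hG hμ hsym hκ hγ hγ' D hchar hn hdvd

/-- ★★★ **THE RANK PROFILE OF THE `a₂ = +1` ROAD**: for every `m ≥ 1`, **`rank W(ℚ_m) = rank W(ℚ₁)` OR `rank W(ℚ_m) = rank W(ℚ₁) + (λ₂ − 1)`** — above `ℚ(√2)` the Mordell–Weil rank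
either never moves or moves ONCE, by exactly `λ₂ − 1 = 2^{n₀}`, in the layer `ℚ_{n₀+1}/ℚ_{n₀}` (two jumps at `n ≠ n'` would give `2ⁿ = λ₂ − 1 = 2^{n'}`).
[cite: Kato2004Asterisque, Thm. 17.4 (1)(2) (p. 273)] [cite: GreenbergLNM1716, Thm. 1.9 (p. 63) and §5 p. 177] -/
theorem mordellWeilRank_layer_eq_or_eq_add_of_road [NeZero (W.conductorNorm ℤ)] {f : CuspForm (Gamma0 (W.conductorNorm ℤ)) 2}
    (h17 : kato_divisibility_allPrimes W 2 (f := f)) (hord : IsOrdinaryAt W 2) (hf : IsNewformOf W f)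
    (ha : W.frobeniusTrace 2 = 1) (hodd : Odd W.tamagawaProduct)
    (hΔ : minimalDiscriminantInt W % 8 = 3 ∨ minimalDiscriminantInt W % 8 = 5) (hr : W.analyticRank = 0)
    {G : IwasawaAlgebra 2} (hG : iwasawaToPowerSeries 2 G = padicLFunction f (unitRoot W 2 : ℚ_[2]))
    (hμ : mu G = 0) (hsym : ‖(ratPlusSymbol f 0 : ℚ_[2])‖ = 1)
    {κ : ZpExtension ℚ 2} {γ : Field.absoluteGaloisGroup ℚ} (hκ : κ.IsCyclotomic) (hγ : κ.IsTopGenerator γ)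
    (hγ' : IsCyclotomicVariable 2 γ) {m : ℕ} (hm : 1 ≤ m) :
    (W.baseChange (κ.layer m)).mordellWeilRank = (W.baseChange (κ.layer 1)).mordellWeilRank ∨
      ((W.baseChange (κ.layer m)).mordellWeilRank = (W.baseChange (κ.layer 1)).mordellWeilRank + (lam G - 1) ∧
        ∃ n, 1 ≤ n ∧ n < m ∧ lam G = 2 ^ n + 1) := by
  induction m, hm using Nat.le_induction with
  | base => exact Or.inl rfl
  | succ m hm ih =>
    rcases mordellWeilRank_layer_succ_eq_or_of_road W h17 hord hf ha hodd hΔ hr hG hμ hsym hκ hγ hγ' hm with hst | ⟨hjump, hlam⟩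
    · rcases ih with h | ⟨h, n, hn1, hnm, hl⟩
      · exact Or.inl (hst.trans h)
      · exact Or.inr ⟨hst.trans h, n, hn1, Nat.lt_succ_of_lt hnm, hl⟩
    · rcases ih with h | ⟨-, n, -, hnm, hl⟩
      · refine Or.inr ⟨?_, m, hm, Nat.lt_succ_self m, hlam⟩
        rw [hjump, h, hlam, Nat.add_sub_cancel]
      · -- a second jump: `2^m + 1 = λ₂ = 2^n + 1` with `n < m`
        exfalso
        have h1 : 2 ^ n = 2 ^ m := by omega
        exact (Nat.ne_of_lt hnm) (Nat.pow_right_injective le_rfl h1)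

/-- ★★ **`+ hGZK`: at every layer `m ≥ 1` of the cyclotomic `ℤ₂`-tower, `rank W(ℚ_m) ≤ 1` OR `λ₂ − 1 ≤ rank W(ℚ_m) ≤ λ₂`** (`rank W(ℚ₁) ≤ 1`, g34); in the second case the
lineage's certificate `Iwasawa.LayerRankGEAt W 2 m 2` holds and the one-bit door gives `MazurMainConjecture W 2` (g34 `mazurMainConjecture_two_of_road_of_layerRankGEAt_two`).
[cite: Kato2004Asterisque, Thm. 17.4 (1)(2) (p. 273)] [cite: GreenbergLNM1716, §5 p. 176] -/
theorem mordellWeilRank_layer_le_one_or_of_road [NeZero (W.conductorNorm ℤ)] {f : CuspForm (Gamma0 (W.conductorNorm ℤ)) 2}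
    (h17 : kato_divisibility_allPrimes W 2 (f := f)) (hGZK : rank_eq_analyticRank_of_analyticRank_le_one)
    (hord : IsOrdinaryAt W 2) (hf : IsNewformOf W f) (ha : W.frobeniusTrace 2 = 1) (hodd : Odd W.tamagawaProduct)
    (hΔ : minimalDiscriminantInt W % 8 = 3 ∨ minimalDiscriminantInt W % 8 = 5) (hr : W.analyticRank = 0)
    {G : IwasawaAlgebra 2} (hG : iwasawaToPowerSeries 2 G = padicLFunction f (unitRoot W 2 : ℚ_[2]))
    (hμ : mu G = 0) (hsym : ‖(ratPlusSymbol f 0 : ℚ_[2])‖ = 1)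
    {κ : ZpExtension ℚ 2} {γ : Field.absoluteGaloisGroup ℚ} (hκ : κ.IsCyclotomic) (hγ : κ.IsTopGenerator γ)
    (hγ' : IsCyclotomicVariable 2 γ) {m : ℕ} (hm : 1 ≤ m) :
    (W.baseChange (κ.layer m)).mordellWeilRank ≤ 1 ∨
      (lam G - 1 ≤ (W.baseChange (κ.layer m)).mordellWeilRank ∧ (W.baseChange (κ.layer m)).mordellWeilRank ≤ lam G) := by
  -- restated in this file's elaboration of `rank W(ℚ₁)` (two defeq spellings of the `ℚ`-algebra structure on a layer)
  have h1 : (W.baseChange (κ.layer 1)).mordellWeilRank ≤ 1 :=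
    AlignedTransportAtTwoLayerOneRankBound.mordellWeilRank_layer_one_le_one_of_road W h17 hGZK hord hf ha hodd hΔ hr hG hsym hκ hγ hγ'
  rcases mordellWeilRank_layer_eq_or_eq_add_of_road W h17 hord hf ha hodd hΔ hr hG hμ hsym hκ hγ hγ' hm with h | ⟨h, n, -, -, hl⟩
  · left; rw [h]; exact h1
  · right
    rw [h]
    have h2 : 1 ≤ 2 ^ n := Nat.one_le_two_pow
    constructor
    · exact Nat.le_add_left _ _
    · calc (W.baseChange (κ.layer 1)).mordellWeilRank + (lam G - 1) ≤ 1 + (lam G - 1) := Nat.add_le_add_right h1 _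
        _ ≤ lam G := by omega

end Summit.BirchSwinnertonDyer.BirchSwinnertonDyer.Theorems.AlignedTransportAtTwoCyclotomicLayerRoadProfile
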